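import Mathlib.Algebra.Order.BigOperators.Group.Finset
import Mathlib.Algebra.BigOperators.Ring.Finset
import Mathlib.Data.Real.Basic
import Mathlib.Data.Set.Lattice
import Mathlib.Data.Fintype.Basic
import Mathlib.Tactic.Linarith
import Mathlib.Tactic.Ring
import Mathlib.Tactic.FieldSimp
import HarnessLib

/-!
# `NoHeavyLowerTail` (stmt-CriticalPhenomena-4575) — antithetic cluster pairs: the TWO-STAGE HARRIS THEOREM, abstract side-1 inequality
# (Steps 2–4 of THEOREM 2H / THEOREM FAT, HOME/THEOREM-FAT.md, prim-hp-2 gen 59)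

Support file (`--supports stmt-CriticalPhenomena-4575`, hull-port prover `prim-hp-2`, gen 59).  No definitions, no named facts, no sorries;
standard axioms.  Pure finite-sum statement (no graphs): the combinatorial heart of THEOREM 2H.

SETTING (HOME/THEOREM-FAT.md §2).  `Ω` = the colourings of side 1 with the colour-swap involution `c`; `(P ω, Q ω)` = the (red, blue)
cluster pair, swapped by `c`; `red ω` = "the edge `sy` is red" (negated by `c`), which forces `y ∈ P ω`; NESTED-UP (hypothesis (H1)):
`red ω ∧ y ∉ Q ω → Q ω ⊆ P ω`; HARRIS ON THE RED-PINNED CUBE (hypothesis `hplus`): `Σ_{red ω} K₁K₂(P ω, Q ω) ≥ 0` for super-odd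
twisted-monotone `K₁, K₂` (for a graph side this is `Antithetic.superodd_cube_sum_nonneg` on the sub-cube `{sy red}`).  The two pairs of test
functions `(gb_i, gt_i)` (= the side-2 averages `ḡ_i, g̃_i` of an odd twisted-increasing `h_i` after inner Harris, THEOREM-FAT §1) are
twisted-monotone and tied by the chain  `−gt(Q,P) ≤ gb(P,Q) ≤ −gb(Q,P) ≤ gt(P,Q)`  (constraints (𝒞)).

**`Antithetic.TwoStage.side_sum_nonneg`**: if `0 ≤ cR ≤ cB` then
  `0 ≤ cB · Σ_{ω : ¬red ω, y ∉ P ω} gb₁gb₂(P ω, Q ω) + cR · Σ_{ω : y ∈ P ω} gt₁gt₂(P ω, Q ω)`.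
With THEOREM-FAT §1 (inner Harris over side 2: `CHANGE ≥` this quantity with `cB = 2^{|E₂|} ≥ cR = #{z ∉ Y₂}`) and
`Antithetic.DegTwo.deg2_vertex_of_change` this is THEOREM 2H / THEOREM FAT (CHANGE ≥ 0 on `({s,y}*H₁) ∪_s fan`, all sizes).
Proof: symmetry of `M = {y ∈ P ∩ Q}` kills the odd×even cross terms; `hplus` with `K_i = o_i(· ∪ {y}, · ∪ {y})` (`o_i` the odd part of
`gt_i`) bounds the deficit on `M` by the `A`-terms; a pointwise inequality on `A = {red, y ∉ Q}` closes (its only input is `cR ≤ cB`).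
[cite: VandenbergHaggstromKahn2005, §1 p. 6 ("Harris' inequality")]
-/

noncomputable section

namespace Summit.CriticalPhenomena.PercolationContinuityZ3.Theorems

open scoped Classical

namespace Antithetic

namespace TwoStage

variable {V : Type*} {Ω : Type*} [Fintype Ω]

/-- The pointwise 2×2 inequality of Step 4 (HOME/THEOREM-FAT.md §2): with `0 ≤ p_i ≤ (a_i + b_i)/2`, `c_i ≥ max(b_i, 0)`, `|b_i| ≤ a_i` and
`0 ≤ cR ≤ cB` (so `a_i + b_i ≥ 2p_i ≥ 0`):  `0 ≤ cB c₁c₂ + cR (a₁a₂ − 2 p₁p₂)`.  Proof: with `β_i = max(b_i,0)` the bound `2p₁p₂ ≤ (a₁+β₁)(a₂+β₂)/2` leaves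
`(cR/2)(a₁−β₁)(a₂−β₂) + (cB − cR) β₁β₂ ≥ 0`. [this work] -/
theorem pointwise_ineq {cB cR a₁ a₂ b₁ b₂ c₁ c₂ p₁ p₂ : ℝ} (hcR : 0 ≤ cR) (hc : cR ≤ cB)
    (hp₁ : 0 ≤ p₁) (hp₂ : 0 ≤ p₂) (hpa₁ : 2 * p₁ ≤ a₁ + b₁) (hpa₂ : 2 * p₂ ≤ a₂ + b₂)
    (hcb₁ : b₁ ≤ c₁) (hcb₂ : b₂ ≤ c₂) (hc₁ : 0 ≤ c₁) (hc₂ : 0 ≤ c₂)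
    (hba₁ : b₁ ≤ a₁) (hba₂ : b₂ ≤ a₂) :
    0 ≤ cB * (c₁ * c₂) + cR * (a₁ * a₂ - 2 * (p₁ * p₂)) := by
  -- β_i = max(b_i, 0)
  set β₁ := max b₁ 0 with hβ₁
  set β₂ := max b₂ 0 with hβ₂
  have hβ₁0 : 0 ≤ β₁ := le_max_right _ _
  have hβ₂0 : 0 ≤ β₂ := le_max_right _ _
  have hβc₁ : β₁ ≤ c₁ := max_le hcb₁ hc₁
  have hβc₂ : β₂ ≤ c₂ := max_le hcb₂ hc₂
  have hβa₁ : β₁ ≤ a₁ := max_le hba₁ (by linarith)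
  have hβa₂ : β₂ ≤ a₂ := max_le hba₂ (by linarith)
  have hbβ₁ : b₁ ≤ β₁ := le_max_left _ _
  have hbβ₂ : b₂ ≤ β₂ := le_max_left _ _
  -- 2 p₁ p₂ ≤ (a₁+β₁)(a₂+β₂)/2
  have h4p : 4 * (p₁ * p₂) ≤ (a₁ + β₁) * (a₂ + β₂) := by
    have e1 : 2 * p₁ ≤ a₁ + β₁ := by linarith
    have e2 : 2 * p₂ ≤ a₂ + β₂ := by linarith
    have := mul_le_mul e1 e2 (by linarith) (by linarith)
    linarith
  -- c₁ c₂ ≥ β₁ β₂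
  have hcc : β₁ * β₂ ≤ c₁ * c₂ := mul_le_mul hβc₁ hβc₂ hβ₂0 hc₁
  have hcB0 : 0 ≤ cB := le_trans hcR hc
  -- the residual identity
  have hres : 0 ≤ cR / 2 * ((a₁ - β₁) * (a₂ - β₂)) + (cB - cR) * (β₁ * β₂) := by
    have t1 : 0 ≤ (a₁ - β₁) * (a₂ - β₂) := mul_nonneg (by linarith) (by linarith)
    have t2 : 0 ≤ β₁ * β₂ := mul_nonneg hβ₁0 hβ₂0
    have t3 : 0 ≤ cR / 2 * ((a₁ - β₁) * (a₂ - β₂)) := mul_nonneg (by linarith) t1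
    have t4 : 0 ≤ (cB - cR) * (β₁ * β₂) := mul_nonneg (by linarith) t2
    linarith
  have hmain : cB * (β₁ * β₂) + cR * (a₁ * a₂ - (a₁ + β₁) * (a₂ + β₂) / 2) =
      cR / 2 * ((a₁ - β₁) * (a₂ - β₂)) + (cB - cR) * (β₁ * β₂) := by ring
  have hstep : cB * (β₁ * β₂) + cR * (a₁ * a₂ - (a₁ + β₁) * (a₂ + β₂) / 2) ≤
      cB * (c₁ * c₂) + cR * (a₁ * a₂ - 2 * (p₁ * p₂)) := by
    have u1 : cB * (β₁ * β₂) ≤ cB * (c₁ * c₂) := mul_le_mul_of_nonneg_left hcc hcB0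
    have u2 : cR * (a₁ * a₂ - (a₁ + β₁) * (a₂ + β₂) / 2) ≤ cR * (a₁ * a₂ - 2 * (p₁ * p₂)) :=
      mul_le_mul_of_nonneg_left (by linarith) hcR
    linarith
  linarith

/-- **The two-stage Harris theorem, abstract side-1 inequality** (Steps 2–4 of HOME/THEOREM-FAT.md §2; hypotheses as in the module
docstring). [this work] -/
theorem side_sum_nonneg (c : Ω → Ω) (hc : Function.Involutive c) (P Q : Ω → Set V)
    (hPc : ∀ ω, P (c ω) = Q ω) (hQc : ∀ ω, Q (c ω) = P ω)
    (red : Ω → Prop) (hred : ∀ ω, red (c ω) ↔ ¬ red ω) (y : V) (hyred : ∀ ω, red ω → y ∈ P ω)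
    (hnest : ∀ ω, red ω → y ∉ Q ω → Q ω ⊆ P ω)
    (hplus : ∀ K₁ K₂ : Set V → Set V → ℝ,
      (∀ ⦃A A' B B' : Set V⦄, A ⊆ A' → B' ⊆ B → K₁ A B ≤ K₁ A' B') → (∀ A B, 0 ≤ K₁ A B + K₁ B A) →
      (∀ ⦃A A' B B' : Set V⦄, A ⊆ A' → B' ⊆ B → K₂ A B ≤ K₂ A' B') → (∀ A B, 0 ≤ K₂ A B + K₂ B A) →
      0 ≤ ∑ ω ∈ Finset.univ.filter (fun ω => red ω), K₁ (P ω) (Q ω) * K₂ (P ω) (Q ω))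
    (gb₁ gt₁ gb₂ gt₂ : Set V → Set V → ℝ)
    (hgb₁ : ∀ ⦃A A' B B' : Set V⦄, A ⊆ A' → B' ⊆ B → gb₁ A B ≤ gb₁ A' B')
    (hgt₁ : ∀ ⦃A A' B B' : Set V⦄, A ⊆ A' → B' ⊆ B → gt₁ A B ≤ gt₁ A' B')
    (hgb₂ : ∀ ⦃A A' B B' : Set V⦄, A ⊆ A' → B' ⊆ B → gb₂ A B ≤ gb₂ A' B')
    (hgt₂ : ∀ ⦃A A' B B' : Set V⦄, A ⊆ A' → B' ⊆ B → gt₂ A B ≤ gt₂ A' B')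
    (hC₁ : ∀ A B, -gt₁ B A ≤ gb₁ A B ∧ gb₁ A B + gb₁ B A ≤ 0 ∧ -gb₁ B A ≤ gt₁ A B)
    (hC₂ : ∀ A B, -gt₂ B A ≤ gb₂ A B ∧ gb₂ A B + gb₂ B A ≤ 0 ∧ -gb₂ B A ≤ gt₂ A B)
    {cB cR : ℝ} (hcR : 0 ≤ cR) (hcBR : cR ≤ cB) :
    0 ≤ cB * ∑ ω ∈ Finset.univ.filter (fun ω => ¬ red ω ∧ y ∉ P ω), gb₁ (P ω) (Q ω) * gb₂ (P ω) (Q ω) +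
      cR * ∑ ω ∈ Finset.univ.filter (fun ω => y ∈ P ω), gt₁ (P ω) (Q ω) * gt₂ (P ω) (Q ω) := by
  -- the classes
  let A : Finset Ω := Finset.univ.filter (fun ω => red ω ∧ y ∉ Q ω)
  let M : Finset Ω := Finset.univ.filter (fun ω => y ∈ P ω ∧ y ∈ Q ω)
  let Mb : Finset Ω := Finset.univ.filter (fun ω => red ω ∧ y ∈ Q ω)
  let Mr : Finset Ω := Finset.univ.filter (fun ω => ¬ red ω ∧ y ∈ P ω)
  -- odd / even parts of gt
  let o₁ : Set V → Set V → ℝ := fun A B => (gt₁ A B - gt₁ B A) / 2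
  let o₂ : Set V → Set V → ℝ := fun A B => (gt₂ A B - gt₂ B A) / 2
  let e₁ : Set V → Set V → ℝ := fun A B => (gt₁ A B + gt₁ B A) / 2
  let e₂ : Set V → Set V → ℝ := fun A B => (gt₂ A B + gt₂ B A) / 2
  have hoe₁ : ∀ A B, gt₁ A B = o₁ A B + e₁ A B := fun A B => by show gt₁ A B = (gt₁ A B - gt₁ B A) / 2 + (gt₁ A B + gt₁ B A) / 2; ring
  have hoe₂ : ∀ A B, gt₂ A B = o₂ A B + e₂ A B := fun A B => by show gt₂ A B = (gt₂ A B - gt₂ B A) / 2 + (gt₂ A B + gt₂ B A) / 2; ring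
  have ho₁odd : ∀ A B, o₁ B A = -o₁ A B := fun A B => by show (gt₁ B A - gt₁ A B) / 2 = -((gt₁ A B - gt₁ B A) / 2); ring
  have ho₂odd : ∀ A B, o₂ B A = -o₂ A B := fun A B => by show (gt₂ B A - gt₂ A B) / 2 = -((gt₂ A B - gt₂ B A) / 2); ring
  have he₁ev : ∀ A B, e₁ B A = e₁ A B := fun A B => by show (gt₁ B A + gt₁ A B) / 2 = (gt₁ A B + gt₁ B A) / 2; ring
  have he₂ev : ∀ A B, e₂ B A = e₂ A B := fun A B => by show (gt₂ B A + gt₂ A B) / 2 = (gt₂ A B + gt₂ B A) / 2; ring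
  have he₁nn : ∀ A B, 0 ≤ e₁ A B := fun A B => by
    have h1 := (hC₁ A B).2.2; have h2 := (hC₁ B A).2.2; have h3 := (hC₁ A B).2.1
    show 0 ≤ (gt₁ A B + gt₁ B A) / 2; linarith
  have he₂nn : ∀ A B, 0 ≤ e₂ A B := fun A B => by
    have h1 := (hC₂ A B).2.2; have h2 := (hC₂ B A).2.2; have h3 := (hC₂ A B).2.1
    show 0 ≤ (gt₂ A B + gt₂ B A) / 2; linarith
  have ho₁mono : ∀ ⦃A A' B B' : Set V⦄, A ⊆ A' → B' ⊆ B → o₁ A B ≤ o₁ A' B' := fun A A' B B' hA hB => by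
    show (gt₁ A B - gt₁ B A) / 2 ≤ (gt₁ A' B' - gt₁ B' A') / 2
    have := hgt₁ hA hB; have := hgt₁ hB hA; linarith
  have ho₂mono : ∀ ⦃A A' B B' : Set V⦄, A ⊆ A' → B' ⊆ B → o₂ A B ≤ o₂ A' B' := fun A A' B B' hA hB => by
    show (gt₂ A B - gt₂ B A) / 2 ≤ (gt₂ A' B' - gt₂ B' A') / 2
    have := hgt₂ hA hB; have := hgt₂ hB hA; linarith
  -- basic facts about the classes
  have hred' : ∀ ω, ¬ red (c ω) ↔ red ω := fun ω => by
    have h := hred (c ω); rw [hc ω] at h; tauto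
  have hnotred_yQ : ∀ ω, ¬ red ω → y ∈ Q ω := fun ω h => by
    have h1 : red (c ω) := (hred ω).2 h
    have h2 := hyred (c ω) h1; rwa [hPc] at h2
  -- (1) the ρ⁻ sum, re-indexed over A by the involution
  have hrho : ∑ ω ∈ Finset.univ.filter (fun ω => ¬ red ω ∧ y ∉ P ω), gb₁ (P ω) (Q ω) * gb₂ (P ω) (Q ω) =
      ∑ ω ∈ A, gb₁ (Q ω) (P ω) * gb₂ (Q ω) (P ω) := by
    refine Finset.sum_nbij' c c ?_ ?_ (fun ω _ => hc ω) (fun ω _ => hc ω) ?_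
    · intro ω hω
      simp only [A, Finset.mem_filter, Finset.mem_univ, true_and] at hω ⊢
      exact ⟨(hred ω).2 hω.1, by rw [hQc]; exact hω.2⟩
    · intro ω hω
      simp only [A, Finset.mem_filter, Finset.mem_univ, true_and] at hω ⊢
      exact ⟨(hred' ω).2 hω.1, by rw [hPc]; exact hω.2⟩
    · intro ω _; rw [hPc, hQc]
  -- (2) the ν⁺ sum splits into A and M
  have hnu : ∑ ω ∈ Finset.univ.filter (fun ω => y ∈ P ω), gt₁ (P ω) (Q ω) * gt₂ (P ω) (Q ω) =
      ∑ ω ∈ A, gt₁ (P ω) (Q ω) * gt₂ (P ω) (Q ω) + ∑ ω ∈ M, gt₁ (P ω) (Q ω) * gt₂ (P ω) (Q ω) := by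
    rw [← Finset.sum_filter_add_sum_filter_not _ (fun ω => y ∈ Q ω), add_comm]
    congr 1
    · refine Finset.sum_congr ?_ fun _ _ => rfl
      ext ω; simp only [A, Finset.mem_filter, Finset.mem_univ, true_and]
      constructor
      · rintro ⟨hP, hQ⟩; exact ⟨by by_contra h; exact hQ (hnotred_yQ ω h), hQ⟩
      · rintro ⟨hr, hQ⟩; exact ⟨hyred ω hr, hQ⟩
    · refine Finset.sum_congr ?_ fun _ _ => rfl
      ext ω; simp only [M, Finset.mem_filter, Finset.mem_univ, true_and]
  -- (3) Step 2: Σ_M gt gt ≥ Σ_M o o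
  have hMswap : ∀ (φ : Set V → Set V → ℝ), ∑ ω ∈ M, φ (Q ω) (P ω) = ∑ ω ∈ M, φ (P ω) (Q ω) := by
    intro φ
    refine Finset.sum_nbij' c c ?_ ?_ (fun ω _ => hc ω) (fun ω _ => hc ω) ?_
    · intro ω hω
      simp only [M, Finset.mem_filter, Finset.mem_univ, true_and] at hω ⊢
      rw [hPc, hQc]; exact ⟨hω.2, hω.1⟩
    · intro ω hω
      simp only [M, Finset.mem_filter, Finset.mem_univ, true_and] at hω ⊢
      rw [hPc, hQc]; exact ⟨hω.2, hω.1⟩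
    · intro ω _; rw [hPc, hQc]
  have hcross : ∑ ω ∈ M, (o₁ (P ω) (Q ω) * e₂ (P ω) (Q ω) + e₁ (P ω) (Q ω) * o₂ (P ω) (Q ω)) = 0 := by
    have h := hMswap (fun A B => o₁ A B * e₂ A B + e₁ A B * o₂ A B)
    have h' : ∑ ω ∈ M, (o₁ (Q ω) (P ω) * e₂ (Q ω) (P ω) + e₁ (Q ω) (P ω) * o₂ (Q ω) (P ω)) =
        -∑ ω ∈ M, (o₁ (P ω) (Q ω) * e₂ (P ω) (Q ω) + e₁ (P ω) (Q ω) * o₂ (P ω) (Q ω)) := by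
      rw [← Finset.sum_neg_distrib]
      refine Finset.sum_congr rfl fun ω _ => ?_
      rw [ho₁odd, ho₂odd, he₁ev, he₂ev]; ring
    linarith
  have hM : ∑ ω ∈ M, o₁ (P ω) (Q ω) * o₂ (P ω) (Q ω) ≤ ∑ ω ∈ M, gt₁ (P ω) (Q ω) * gt₂ (P ω) (Q ω) := by
    have hexp : ∑ ω ∈ M, gt₁ (P ω) (Q ω) * gt₂ (P ω) (Q ω) = ∑ ω ∈ M, o₁ (P ω) (Q ω) * o₂ (P ω) (Q ω) +
        ∑ ω ∈ M, (o₁ (P ω) (Q ω) * e₂ (P ω) (Q ω) + e₁ (P ω) (Q ω) * o₂ (P ω) (Q ω)) +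
        ∑ ω ∈ M, e₁ (P ω) (Q ω) * e₂ (P ω) (Q ω) := by
      rw [← Finset.sum_add_distrib, ← Finset.sum_add_distrib]
      refine Finset.sum_congr rfl fun ω _ => ?_
      rw [hoe₁ (P ω) (Q ω), hoe₂ (P ω) (Q ω)]; ring
    have hee : 0 ≤ ∑ ω ∈ M, e₁ (P ω) (Q ω) * e₂ (P ω) (Q ω) :=
      Finset.sum_nonneg fun ω _ => mul_nonneg (he₁nn _ _) (he₂nn _ _)
    rw [hexp, hcross]; linarith
  -- (4) Σ_M o o = 2 Σ_Mb o o
  have hMsplit : ∑ ω ∈ M, o₁ (P ω) (Q ω) * o₂ (P ω) (Q ω) =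
      ∑ ω ∈ Mb, o₁ (P ω) (Q ω) * o₂ (P ω) (Q ω) + ∑ ω ∈ Mr, o₁ (P ω) (Q ω) * o₂ (P ω) (Q ω) := by
    rw [← Finset.sum_filter_add_sum_filter_not M (fun ω => red ω)]
    congr 1
    · refine Finset.sum_congr ?_ fun _ _ => rfl
      ext ω; simp only [M, Mb, Finset.mem_filter, Finset.mem_univ, true_and]
      constructor
      · rintro ⟨⟨_, hQ⟩, hr⟩; exact ⟨hr, hQ⟩
      · rintro ⟨hr, hQ⟩; exact ⟨⟨hyred ω hr, hQ⟩, hr⟩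
    · refine Finset.sum_congr ?_ fun _ _ => rfl
      ext ω; simp only [M, Mr, Finset.mem_filter, Finset.mem_univ, true_and]
      constructor
      · rintro ⟨⟨hP, _⟩, hr⟩; exact ⟨hr, hP⟩
      · rintro ⟨hr, hP⟩; exact ⟨⟨hP, hnotred_yQ ω hr⟩, hr⟩
  have hMr : ∑ ω ∈ Mr, o₁ (P ω) (Q ω) * o₂ (P ω) (Q ω) = ∑ ω ∈ Mb, o₁ (P ω) (Q ω) * o₂ (P ω) (Q ω) := by
    refine Finset.sum_nbij' c c ?_ ?_ (fun ω _ => hc ω) (fun ω _ => hc ω) ?_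
    · intro ω hω
      simp only [Mr, Mb, Finset.mem_filter, Finset.mem_univ, true_and] at hω ⊢
      exact ⟨(hred ω).2 hω.1, by rw [hQc]; exact hω.2⟩
    · intro ω hω
      simp only [Mr, Mb, Finset.mem_filter, Finset.mem_univ, true_and] at hω ⊢
      exact ⟨(hred' ω).2 hω.1, by rw [hPc]; exact hω.2⟩
    · intro ω _; rw [hPc, hQc, ho₁odd, ho₂odd]; ring
  -- (5) Step 3: Harris on the red cube with K_i = o_i (· ∪ {y}) (· ∪ {y})
  let K₁ : Set V → Set V → ℝ := fun A B => o₁ (A ∪ {y}) (B ∪ {y})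
  let K₂ : Set V → Set V → ℝ := fun A B => o₂ (A ∪ {y}) (B ∪ {y})
  have hK₁mono : ∀ ⦃A A' B B' : Set V⦄, A ⊆ A' → B' ⊆ B → K₁ A B ≤ K₁ A' B' := fun A A' B B' hA hB =>
    ho₁mono (Set.union_subset_union_left _ hA) (Set.union_subset_union_left _ hB)
  have hK₂mono : ∀ ⦃A A' B B' : Set V⦄, A ⊆ A' → B' ⊆ B → K₂ A B ≤ K₂ A' B' := fun A A' B B' hA hB =>
    ho₂mono (Set.union_subset_union_left _ hA) (Set.union_subset_union_left _ hB)
  have hK₁so : ∀ A B, 0 ≤ K₁ A B + K₁ B A := fun A B => by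
    show 0 ≤ o₁ (A ∪ {y}) (B ∪ {y}) + o₁ (B ∪ {y}) (A ∪ {y}); have := ho₁odd (A ∪ {y}) (B ∪ {y}); linarith
  have hK₂so : ∀ A B, 0 ≤ K₂ A B + K₂ B A := fun A B => by
    show 0 ≤ o₂ (A ∪ {y}) (B ∪ {y}) + o₂ (B ∪ {y}) (A ∪ {y}); have := ho₂odd (A ∪ {y}) (B ∪ {y}); linarith
  have hH := hplus K₁ K₂ hK₁mono hK₁so hK₂mono hK₂so
  -- split the red sum into A and Mb
  have hredsplit : ∑ ω ∈ Finset.univ.filter (fun ω => red ω), K₁ (P ω) (Q ω) * K₂ (P ω) (Q ω) =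
      ∑ ω ∈ A, K₁ (P ω) (Q ω) * K₂ (P ω) (Q ω) + ∑ ω ∈ Mb, o₁ (P ω) (Q ω) * o₂ (P ω) (Q ω) := by
    rw [← Finset.sum_filter_add_sum_filter_not _ (fun ω => y ∈ Q ω), add_comm]
    congr 1
    · refine Finset.sum_congr ?_ fun _ _ => rfl
      ext ω; simp only [A, Finset.mem_filter, Finset.mem_univ, true_and]
    · refine Finset.sum_congr ?_ ?_
      · ext ω; simp only [Mb, Finset.mem_filter, Finset.mem_univ, true_and]
      · intro ω hω
        simp only [Mb, Finset.mem_filter, Finset.mem_univ, true_and] at hω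
        have hP : P ω ∪ {y} = P ω := Set.union_eq_self_of_subset_right (Set.singleton_subset_iff.2 (hyred ω hω.1))
        have hQ : Q ω ∪ {y} = Q ω := Set.union_eq_self_of_subset_right (Set.singleton_subset_iff.2 hω.2)
        show o₁ (P ω ∪ {y}) (Q ω ∪ {y}) * o₂ (P ω ∪ {y}) (Q ω ∪ {y}) = o₁ (P ω) (Q ω) * o₂ (P ω) (Q ω)
        rw [hP, hQ]
  -- (6) assemble the lower bound Σ_A [cB c₁c₂ + cR (a₁a₂ − 2 p₁p₂)] and close pointwise
  have hlow : ∑ ω ∈ A, (cB * (gb₁ (Q ω) (P ω) * gb₂ (Q ω) (P ω)) +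
        cR * (gt₁ (P ω) (Q ω) * gt₂ (P ω) (Q ω) - 2 * (K₁ (P ω) (Q ω) * K₂ (P ω) (Q ω)))) =
      cB * ∑ ω ∈ A, gb₁ (Q ω) (P ω) * gb₂ (Q ω) (P ω) +
      cR * (∑ ω ∈ A, gt₁ (P ω) (Q ω) * gt₂ (P ω) (Q ω) - 2 * ∑ ω ∈ A, K₁ (P ω) (Q ω) * K₂ (P ω) (Q ω)) := by
    rw [Finset.sum_add_distrib, ← Finset.mul_sum, ← Finset.mul_sum, Finset.sum_sub_distrib, ← Finset.mul_sum]
  have hterm : ∀ ω ∈ A, 0 ≤ cB * (gb₁ (Q ω) (P ω) * gb₂ (Q ω) (P ω)) +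
      cR * (gt₁ (P ω) (Q ω) * gt₂ (P ω) (Q ω) - 2 * (K₁ (P ω) (Q ω) * K₂ (P ω) (Q ω))) := by
    intro ω hω
    simp only [A, Finset.mem_filter, Finset.mem_univ, true_and] at hω
    obtain ⟨hr, hyQ⟩ := hω
    have hyP : y ∈ P ω := hyred ω hr
    have hQP : Q ω ⊆ P ω := hnest ω hr hyQ
    have hPy : P ω ∪ {y} = P ω := Set.union_eq_self_of_subset_right (Set.singleton_subset_iff.2 hyP)
    have hQyP : Q ω ∪ {y} ⊆ P ω := Set.union_subset hQP (Set.singleton_subset_iff.2 hyP)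
    have hQQy : Q ω ⊆ Q ω ∪ {y} := Set.subset_union_left
    -- the numbers
    have key : ∀ {gb gt : Set V → Set V → ℝ},
        (∀ ⦃A A' B B' : Set V⦄, A ⊆ A' → B' ⊆ B → gb A B ≤ gb A' B') →
        (∀ ⦃A A' B B' : Set V⦄, A ⊆ A' → B' ⊆ B → gt A B ≤ gt A' B') →
        (∀ A B, -gt B A ≤ gb A B ∧ gb A B + gb B A ≤ 0 ∧ -gb B A ≤ gt A B) →
        0 ≤ (gt (P ω) (Q ω ∪ {y}) - gt (Q ω ∪ {y}) (P ω)) / 2 ∧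
        2 * ((gt (P ω) (Q ω ∪ {y}) - gt (Q ω ∪ {y}) (P ω)) / 2) ≤ gt (P ω) (Q ω) + gb (P ω) (Q ω) ∧
        gb (P ω) (Q ω) ≤ -gb (Q ω) (P ω) ∧ 0 ≤ -gb (Q ω) (P ω) ∧ gb (P ω) (Q ω) ≤ gt (P ω) (Q ω) := by
      intro gb gt hgb hgt hC
      have f1 : gt (Q ω ∪ {y}) (P ω) ≤ gt (P ω) (Q ω ∪ {y}) := hgt hQyP hQyP
      have f2a : gt (P ω) (Q ω ∪ {y}) ≤ gt (P ω) (Q ω) := hgt subset_rfl hQQy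
      have f2b : -gt (Q ω ∪ {y}) (P ω) ≤ gb (P ω) (Q ω ∪ {y}) := (hC (P ω) (Q ω ∪ {y})).1
      have f2c : gb (P ω) (Q ω ∪ {y}) ≤ gb (P ω) (Q ω) := hgb subset_rfl hQQy
      have f3a : gb (P ω) (Q ω) + gb (Q ω) (P ω) ≤ 0 := (hC (P ω) (Q ω)).2.1
      have f3b : gb (Q ω) (P ω) ≤ gb (P ω) (P ω) := hgb hQP subset_rfl
      have f3c : gb (P ω) (P ω) + gb (P ω) (P ω) ≤ 0 := (hC (P ω) (P ω)).2.1
      have f4a : gb (P ω) (Q ω) ≤ -gb (Q ω) (P ω) := by linarith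
      have f4b : -gb (Q ω) (P ω) ≤ gt (P ω) (Q ω) := (hC (P ω) (Q ω)).2.2
      have f4c : -gt (Q ω) (P ω) ≤ gb (P ω) (Q ω) := (hC (P ω) (Q ω)).1
      have f4d : gt (Q ω) (P ω) ≤ gt (P ω) (Q ω) := hgt hQP hQP
      refine ⟨by linarith, by linarith, f4a, by linarith, by linarith⟩
    obtain ⟨k1a, k1b, k1c, k1d, k1e⟩ := key hgb₁ hgt₁ hC₁
    obtain ⟨k2a, k2b, k2c, k2d, k2e⟩ := key hgb₂ hgt₂ hC₂
    have hK₁val : K₁ (P ω) (Q ω) = (gt₁ (P ω) (Q ω ∪ {y}) - gt₁ (Q ω ∪ {y}) (P ω)) / 2 := by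
      show o₁ (P ω ∪ {y}) (Q ω ∪ {y}) = _; rw [hPy]
    have hK₂val : K₂ (P ω) (Q ω) = (gt₂ (P ω) (Q ω ∪ {y}) - gt₂ (Q ω ∪ {y}) (P ω)) / 2 := by
      show o₂ (P ω ∪ {y}) (Q ω ∪ {y}) = _; rw [hPy]
    have hcc : gb₁ (Q ω) (P ω) * gb₂ (Q ω) (P ω) = (-gb₁ (Q ω) (P ω)) * (-gb₂ (Q ω) (P ω)) := by ring
    rw [hK₁val, hK₂val, hcc]
    exact pointwise_ineq (a₁ := gt₁ (P ω) (Q ω)) (a₂ := gt₂ (P ω) (Q ω)) (b₁ := gb₁ (P ω) (Q ω)) (b₂ := gb₂ (P ω) (Q ω))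
      hcR hcBR k1a k2a k1b k2b k1c k2c k1d k2d k1e k2e
  -- final assembly
  have hA2 : 0 ≤ ∑ ω ∈ A, K₁ (P ω) (Q ω) * K₂ (P ω) (Q ω) + ∑ ω ∈ Mb, o₁ (P ω) (Q ω) * o₂ (P ω) (Q ω) := by
    rw [← hredsplit]; exact hH
  rw [hrho, hnu]
  have hfin : 0 ≤ ∑ ω ∈ A, (cB * (gb₁ (Q ω) (P ω) * gb₂ (Q ω) (P ω)) +
      cR * (gt₁ (P ω) (Q ω) * gt₂ (P ω) (Q ω) - 2 * (K₁ (P ω) (Q ω) * K₂ (P ω) (Q ω)))) :=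
    Finset.sum_nonneg hterm
  rw [hlow] at hfin
  have hMge : 2 * ∑ ω ∈ Mb, o₁ (P ω) (Q ω) * o₂ (P ω) (Q ω) ≤ ∑ ω ∈ M, gt₁ (P ω) (Q ω) * gt₂ (P ω) (Q ω) := by
    have := hM; rw [hMsplit, hMr] at this; linarith
  nlinarith [hfin, hMge, hA2, hcR, mul_le_mul_of_nonneg_left hMge hcR]

end TwoStage

end Antithetic

end Summit.CriticalPhenomena.PercolationContinuityZ3.Theorems
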